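import Summits.Ventures.HSemireg.UntwistSigmaMultiplier
import Summits.Ventures.HSemireg.UntwistDerivedAdjunction
import Summits.Ventures.HSemireg.UntwistGerbePullback
import HarnessLib

/-!
# Venture HSemireg — route R1.0 ASSEMBLED: Leibniz data + the real comparison `θ` ⇒ untwisting preserves
# FULL semiregularity, one theorem per carrier level (sheaves on `X₀`, sheaves on the gerbe, complexes)

HONEST FRAMING. This file only COMPOSES the th-4 files: the multiplier formula of `UntwistSigmaMultiplier.lean`
(first implication of R1.0 (iii): the Leibniz rule `At(E′) = θ(At E) + c` with `c` commuting, plus the trace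
compatibilities, give the triangular re-expansion of the components `σ_q` with EXPLICIT mixing maps) with the
files in which the comparison `θ : Ext²(E, E) → Ext²(E′, E′)` is a REAL map — `UntwistExtEquivalence.lean`
(`θ = Φ.mapExt` for an equivalence `Φ`, untwisted reading `E′ = E₀ ⊗ M_B` on `X₀` itself),
`UntwistGerbePullback.lean` (`θ = (F ⋙ Φ).mapExt` for a block inclusion `G ⊣ F`, intended `π_* ⊣ π^*`, and an
equivalence `Φ`, intended `- ⊗ L^{∓1}`), `UntwistDerivedAdjunction.lean` (complex carriers
`Hom_{D(X₀)}(E₀, E₀⟦2⟧)`, `θ x = Ψ x ≫ (Ψ.commShiftIso 2)_{E₀}` for `Ψ = D(F) ⋙ D(Φe)`, `F ⊣ R` an exact adjoint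
pair with `F` full and faithful, `Φe` an equivalence). In each of the three theorems below EVERY input of R1.0
is a named binder and nothing else is assumed: (a) the functorial data realising `θ`; (b) the Buchweitz–Flenner
algebra data `(R, R′, θ, a, a′, c, τ, τ′, d, μ, ι, ι′)` of `UntwistSigmaMultiplier` with the LEIBNIZ RULE
`a′ = θ a + c` [Atiyah1957, Prop. 10–12; HuybrechtsLehn1997, §10.1.5], the COMMUTATION `Commute (θ a) c`
(interchange law of `- ⊗ -` for two classes of even total degree; [HuybrechtsLehn1997] §10.1.5 / §10.1.1) and the
trace compatibilities `hd`, `hμ` [BuchweitzFlenner2003, §4.1, Rem. 4.7 (1)], tied to the real `θ` by `hθ₀ : ι′ ∘ θ = θ_R ∘ ι` and to the components by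
`σ_q(ξ) = τ_q(ι ξ · a^q)`; (c) injectivity of the diagonal `d_q` (intended `π^*` on `H^{q+2}(Ω^q)`, a retraction
of `π_*`; or `id`). No variety, gerbe or functor is constructed; no definition, no named fact; nothing here says
HC, HC_CM or HC_AV is proved. Numbers of the STEP-0 component, by value only: `Ext²_{X₀}(E₀, E₀)` of dimension
`18`, `⊕_q H^{q+2}(X₀, Ω^q)` of dimension `28`, `rk E₀ = -2`, `c₁(L) = c₁(P)/2`.

What is NOT here (unchanged): the ring `A_E` and the Leibniz rule on real carriers, the functors `π^*`,
`- ⊗ L^{∓1}`, `- ⊗ M_B` themselves, `σ_q` for complexes (abstract family on `Hom(E₀, E₀⟦2⟧)`), tameness.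

## References

* [Atiyah1957] M. F. Atiyah, Trans. Amer. Math. Soc. 85 (1957), Prop. 10–12 (pp. 195–196).
* [BuchweitzFlenner2003] R.-O. Buchweitz, H. Flenner, Compositio Math. 137 (2003): Prop. 3.14, §4.1,
  Def. 4.1, Rem. 4.7 (1), §5 (Prop. 3.12 = the form-degree-`0` frame of the commutation, see
  `UntwistSigmaMultiplier`).
* [HuybrechtsLehn1997] D. Huybrechts, M. Lehn, *The geometry of moduli spaces of sheaves* (2nd ed. pages),
  §10.1.3–10.1.5.
* [GortzWedhorn2023] U. Görtz, T. Wedhorn, *Algebraic Geometry II*, Prop. F.191 (derived adjunction).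
* [Lieblich2007] M. Lieblich, *Moduli of twisted sheaves*, Duke Math. J. 138 (2007), arXiv Lemma 2.1.1.12,
  Prop. 2.2.1.6.
-/

namespace Summit.Ventures.HSemireg

open Finset CategoryTheory CategoryTheory.Abelian CategoryTheory.Limits AlgebraicGeometry

/-! ### 1. Untwisted reading (`E′ = E₀ ⊗ M_B` on `X₀` itself): real `σ_q`, `θ = Φ.mapExt` -/

section SameScheme

open Literature.AlgebraicGeometry.Motives Literature.AlgebraicGeometry.HodgeTheory
  Literature.AlgebraicGeometry.Modules

universe w w' u

variable {S : Type u} [CommRing S] {X : Over (Spec (CommRingCat.of S))} [HasExt.{w} X.left.Modules]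
  {S' : Type u} [CommRing S'] {X' : Over (Spec (CommRingCat.of S'))} [HasExt.{w'} X'.left.Modules]
  (Φ : X.left.Modules ≌ X'.left.Modules) [Φ.functor.Additive]
  {E : X.left.Modules} (hE : IsFiniteLocallyFree E) (hE' : IsFiniteLocallyFree (Φ.functor.obj E))
  {R R' : Type*} [Ring R] [Ring R']

/-- **R1.0 assembled on the tree's real carriers `σ_q = sigmaHigher`, untwisted reading.** `Φ : Mod(𝒪_X) ≌
Mod(𝒪_{X′})` an additive equivalence (intended `- ⊗ M_B` on `X₀`, or `- ⊗ L^{∓1}`), `E` and `Φ E` finite locally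
free; Buchweitz–Flenner algebra data with the Leibniz rule `a′ = θ a + c`, the commutation `Commute (θ a) c` and the trace
compatibilities, realising the REAL components (`σ_q^E(ξ) = τ_q(ι ξ · a^q)`, `σ_q^{Φ E}(ξ′) = τ′_q(ι′ ξ′ · a′^q)`)
and the REAL comparison (`ι′ ∘ Φ.mapExt = θ ∘ ι`); diagonal `d_q` injective on a LOWER set `I`. Then `E` is
`I`-semiregular iff `Φ E` is (`I = univ`: «`σ_{E₀′}` injective iff `σ_{E₀}` is»).
[cite: BuchweitzFlenner2003, Def. 4.1 and §5; Atiyah1957, Prop. 10–12] -/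
theorem isISemiregular_iff_of_equivalence_of_leibniz (θ : R →+* R') {a : R} {a' c : R'}
    (ha' : a' = θ a + c) (hc : Commute (θ a) c)
    (τ : ∀ q, R →+ hodgeCohomology X q (q + 2)) (τ' : ∀ q, R' →+ hodgeCohomology X' q (q + 2))
    (d : ∀ q, hodgeCohomology X q (q + 2) →+ hodgeCohomology X' q (q + 2))
    (hd : ∀ (q : ℕ) (y : R), τ' q (θ y) = d q (τ q y))
    (μ : ∀ q j, hodgeCohomology X' j (j + 2) →+ hodgeCohomology X' q (q + 2))
    (hμ : ∀ (q j : ℕ) (y : R'), j ≤ q → τ' q (y * c ^ (q - j)) = μ q j (τ' j y))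
    (ι : Ext.{w} E E 2 →+ R) (ι' : Ext.{w'} (Φ.functor.obj E) (Φ.functor.obj E) 2 →+ R')
    (hθ₀ : ∀ ξ, ι' (Φ.functor.mapExtAddHom E E 2 ξ) = θ (ι ξ))
    (hσ : ∀ (q : ℕ) (ξ : Ext.{w} E E 2), sigmaHigher hE q ξ = τ q (ι ξ * a ^ q))
    (hσ' : ∀ (q : ℕ) (ξ' : Ext.{w'} (Φ.functor.obj E) (Φ.functor.obj E) 2),
      sigmaHigher hE' q ξ' = τ' q (ι' ξ' * a' ^ q))
    {I : Set ℕ} (hI : IsLowerSet I) (hdI : ∀ q ∈ I, Function.Injective (d q)) :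
    IsISemiregular.{w} hE I ↔ IsISemiregular.{w'} hE' I :=
  isISemiregular_iff_of_equivalence Φ hE hE' d
    (fun q j => (μ q j).comp ((d j).comp (DistribSMul.toAddMonoidHom _ (q.choose j)))) hI hdI
    fun q _ ξ => sigma_leibniz_triangular (σ := fun q => sigmaHigher hE q) (σ' := fun q => sigmaHigher hE' q)
      θ ha' hc τ τ' d hd μ hμ ι ι' (Φ.functor.mapExtAddHom E E 2) hθ₀ hσ hσ' q ξ

/-- **FULL semiregularity, untwisted reading** (`I = univ`). [cite: BuchweitzFlenner2003, Def. 4.1 and §5] -/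
theorem isISemiregular_univ_iff_of_equivalence_of_leibniz (θ : R →+* R') {a : R} {a' c : R'}
    (ha' : a' = θ a + c) (hc : Commute (θ a) c)
    (τ : ∀ q, R →+ hodgeCohomology X q (q + 2)) (τ' : ∀ q, R' →+ hodgeCohomology X' q (q + 2))
    (d : ∀ q, hodgeCohomology X q (q + 2) →+ hodgeCohomology X' q (q + 2))
    (hd : ∀ (q : ℕ) (y : R), τ' q (θ y) = d q (τ q y))
    (μ : ∀ q j, hodgeCohomology X' j (j + 2) →+ hodgeCohomology X' q (q + 2))
    (hμ : ∀ (q j : ℕ) (y : R'), j ≤ q → τ' q (y * c ^ (q - j)) = μ q j (τ' j y))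
    (ι : Ext.{w} E E 2 →+ R) (ι' : Ext.{w'} (Φ.functor.obj E) (Φ.functor.obj E) 2 →+ R')
    (hθ₀ : ∀ ξ, ι' (Φ.functor.mapExtAddHom E E 2 ξ) = θ (ι ξ))
    (hσ : ∀ (q : ℕ) (ξ : Ext.{w} E E 2), sigmaHigher hE q ξ = τ q (ι ξ * a ^ q))
    (hσ' : ∀ (q : ℕ) (ξ' : Ext.{w'} (Φ.functor.obj E) (Φ.functor.obj E) 2),
      sigmaHigher hE' q ξ' = τ' q (ι' ξ' * a' ^ q))
    (hdI : ∀ q, Function.Injective (d q)) :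
    IsISemiregular.{w} hE Set.univ ↔ IsISemiregular.{w'} hE' Set.univ :=
  isISemiregular_iff_of_equivalence_of_leibniz Φ hE hE' θ ha' hc τ τ' d hd μ hμ ι ι' hθ₀ hσ hσ' isLowerSet_univ
    fun q _ => hdI q

end SameScheme

/-! ### 2. Gerbe reading, sheaf carriers: real source `σ_q`, `θ = (F ⋙ Φ).mapExt` for a block inclusion -/

section Gerbe

open Literature.AlgebraicGeometry.Motives Literature.AlgebraicGeometry.HodgeTheory
  Literature.AlgebraicGeometry.Modules

universe w w'' v' v'' u u' u''

variable {S : Type u} [CommRing S] {X : Over (Spec (CommRingCat.of S))} [HasExt.{w} X.left.Modules]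
  {D : Type u'} [Category.{v'} D] [Abelian D] {D' : Type u''} [Category.{v''} D'] [Abelian D']
  {F : X.left.Modules ⥤ D} {G : D ⥤ X.left.Modules} (adj : G ⊣ F) [G.PreservesMonomorphisms]
  [F.Additive] [F.Full] [F.Faithful] [PreservesFiniteLimits F] [PreservesFiniteColimits F]
  (Φ : D ≌ D') [Φ.functor.Additive] [HasExt.{w''} D']
  {E : X.left.Modules} (hE : IsFiniteLocallyFree E)
  {W' : ℕ → Type*} [∀ q, AddCommGroup (W' q)]
  (σ' : ∀ q, Ext.{w''} ((F ⋙ Φ.functor).obj E) ((F ⋙ Φ.functor).obj E) 2 →+ W' q)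
  {R R' : Type*} [Ring R] [Ring R']

include adj

/-- **R1.0 assembled on sheaf carriers, gerbe reading, the direction the route consumes.** `E` finite
locally free on `X/S` (real `σ_q = sigmaHigher hE q`), `G ⊣ F` a block inclusion out of `Mod(𝒪_X)` (intended
`π_* ⊣ π^*`, `F` additive exact full faithful, `G` mono-preserving — the weight-`0` splitting,
`UntwistGerbeWeights`), `Φ : D ≌ D′` (intended `- ⊗ L^{∓1}`), `σ′_q` ANY additive components on
`Ext²(Φ F E, Φ F E)` (no gerbe carrier in the tree) realised with the source components by Buchweitz–Flenner
algebra data satisfying the Leibniz rule, the commutation and the trace compatibilities, with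
`ι′ ∘ (F ⋙ Φ).mapExt = θ ∘ ι`; diagonals `d_q` injective (intended `π^*`). Then FULL semiregularity of `E`
gives joint injectivity of all `σ′_q`. [cite: BuchweitzFlenner2003, Def. 4.1 and §5; Atiyah1957, Prop. 10–12;
Lieblich2007, arXiv Prop. 2.2.1.6] -/
theorem jointlyInjective_of_isISemiregular_univ_of_leftAdjoint_of_leibniz (θ : R →+* R') {a : R}
    {a' c : R'} (ha' : a' = θ a + c) (hc : Commute (θ a) c)
    (τ : ∀ q, R →+ hodgeCohomology X q (q + 2)) (τ' : ∀ q, R' →+ W' q)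
    (d : ∀ q, hodgeCohomology X q (q + 2) →+ W' q)
    (hd : ∀ (q : ℕ) (y : R), τ' q (θ y) = d q (τ q y))
    (μ : ∀ q j, W' j →+ W' q)
    (hμ : ∀ (q j : ℕ) (y : R'), j ≤ q → τ' q (y * c ^ (q - j)) = μ q j (τ' j y))
    (ι : Ext.{w} E E 2 →+ R) (ι' : Ext.{w''} ((F ⋙ Φ.functor).obj E) ((F ⋙ Φ.functor).obj E) 2 →+ R')
    (hθ₀ : ∀ ξ, ι' ((F ⋙ Φ.functor).mapExtAddHom E E 2 ξ) = θ (ι ξ))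
    (hσ : ∀ (q : ℕ) (ξ : Ext.{w} E E 2), sigmaHigher hE q ξ = τ q (ι ξ * a ^ q))
    (hσ' : ∀ (q : ℕ) (ξ' : Ext.{w''} ((F ⋙ Φ.functor).obj E) ((F ⋙ Φ.functor).obj E) 2),
      σ' q ξ' = τ' q (ι' ξ' * a' ^ q))
    (hdI : ∀ q, Function.Injective (d q)) (h : IsISemiregular.{w} hE Set.univ)
    (x' : Ext.{w''} ((F ⋙ Φ.functor).obj E) ((F ⋙ Φ.functor).obj E) 2) (hx' : ∀ q, σ' q x' = 0) :
    x' = 0 :=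
  jointlyInjective_of_isISemiregular_univ_of_leftAdjoint_comp_equivalence adj Φ hE σ' d
    (fun q j => (μ q j).comp ((d j).comp (DistribSMul.toAddMonoidHom _ (q.choose j)))) hdI
    (fun q ξ => sigma_leibniz_triangular (σ := fun q => sigmaHigher hE q) (σ' := σ') θ ha' hc τ τ' d hd μ hμ
      ι ι' ((F ⋙ Φ.functor).mapExtAddHom E E 2) hθ₀ hσ hσ' q ξ) h x' hx'

/-- **R1.0 assembled on sheaf carriers, gerbe reading, both directions** on a lower set `I`.
[cite: BuchweitzFlenner2003, §5 (I-semiregular); Lieblich2007, arXiv Prop. 2.2.1.6] -/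
theorem isISemiregular_iff_jointlyInjective_of_leftAdjoint_of_leibniz (θ : R →+* R') {a : R}
    {a' c : R'} (ha' : a' = θ a + c) (hc : Commute (θ a) c)
    (τ : ∀ q, R →+ hodgeCohomology X q (q + 2)) (τ' : ∀ q, R' →+ W' q)
    (d : ∀ q, hodgeCohomology X q (q + 2) →+ W' q)
    (hd : ∀ (q : ℕ) (y : R), τ' q (θ y) = d q (τ q y))
    (μ : ∀ q j, W' j →+ W' q)
    (hμ : ∀ (q j : ℕ) (y : R'), j ≤ q → τ' q (y * c ^ (q - j)) = μ q j (τ' j y))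
    (ι : Ext.{w} E E 2 →+ R) (ι' : Ext.{w''} ((F ⋙ Φ.functor).obj E) ((F ⋙ Φ.functor).obj E) 2 →+ R')
    (hθ₀ : ∀ ξ, ι' ((F ⋙ Φ.functor).mapExtAddHom E E 2 ξ) = θ (ι ξ))
    (hσ : ∀ (q : ℕ) (ξ : Ext.{w} E E 2), sigmaHigher hE q ξ = τ q (ι ξ * a ^ q))
    (hσ' : ∀ (q : ℕ) (ξ' : Ext.{w''} ((F ⋙ Φ.functor).obj E) ((F ⋙ Φ.functor).obj E) 2),
      σ' q ξ' = τ' q (ι' ξ' * a' ^ q))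
    {I : Set ℕ} (hI : IsLowerSet I) (hdI : ∀ q ∈ I, Function.Injective (d q)) :
    IsISemiregular.{w} hE I ↔
      ∀ x' : Ext.{w''} ((F ⋙ Φ.functor).obj E) ((F ⋙ Φ.functor).obj E) 2,
        (∀ q ∈ I, σ' q x' = 0) → x' = 0 :=
  isISemiregular_iff_jointlyInjective_of_leftAdjoint_comp_equivalence adj Φ hE σ' d
    (fun q j => (μ q j).comp ((d j).comp (DistribSMul.toAddMonoidHom _ (q.choose j)))) hI hdI
    fun q _ ξ => sigma_leibniz_triangular (σ := fun q => sigmaHigher hE q) (σ' := σ') θ ha' hc τ τ' d hd μ hμ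
      ι ι' ((F ⋙ Φ.functor).mapExtAddHom E E 2) hθ₀ hσ hσ' q ξ

end Gerbe

/-! ### 3. Complex carriers `Hom_{D(X₀)}(E₀, E₀⟦2⟧)`: `θ` from the exact adjoint pair and the equivalence -/

section Complex

universe w w₂ w₃ v₂ v₃ u u₂ u₃

variable {S : Type u} [CommRing S] {X₀ : Over (Spec (CommRingCat.of S))}
  [HasDerivedCategory.{w} X₀.left.Modules]
  {C₂ : Type u₂} [Category.{v₂} C₂] [Abelian C₂] [HasDerivedCategory.{w₂} C₂]
  {C₃ : Type u₃} [Category.{v₃} C₃] [Abelian C₃] [HasDerivedCategory.{w₃} C₃]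
  {F : X₀.left.Modules ⥤ C₂} {Rf : C₂ ⥤ X₀.left.Modules} [F.Additive] [Rf.Additive]
  [PreservesFiniteLimits F] [PreservesFiniteColimits F]
  [PreservesFiniteLimits Rf] [PreservesFiniteColimits Rf] (adj : F ⊣ Rf) [F.Full] [F.Faithful]
  (Φe : C₂ ≌ C₃) [Φe.functor.Additive] [Φe.inverse.Additive]
  (E₀ : CochainComplex X₀.left.Modules ℤ)
  {W W' : ℕ → Type*} [∀ q, AddCommGroup (W q)] [∀ q, AddCommGroup (W' q)]
  {σ : ∀ q, (DerivedCategory.Q.obj E₀ ⟶ (DerivedCategory.Q.obj E₀)⟦(2 : ℤ)⟧) →+ W q}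
  {σ' : ∀ q, ((F.mapDerivedCategory ⋙ Φe.functor.mapDerivedCategory).obj (DerivedCategory.Q.obj E₀) ⟶
    ((F.mapDerivedCategory ⋙ Φe.functor.mapDerivedCategory).obj (DerivedCategory.Q.obj E₀))⟦(2 : ℤ)⟧) →+
      W' q}
  {R R' : Type*} [Ring R] [Ring R']

include adj

/-- **R1.0 assembled for a COMPLEX `E₀` on `X₀/S`, the direction the route consumes, every input a binder.**
(a) `F ⊣ Rf` an adjoint pair of EXACT functors out of `Mod(𝒪_{X₀})` with `F` full and faithful (intended
`π^* ⊣ π_*` for the tame `μ₂`-gerbe; `π^*π_* = id` on weight `0`) and `Φe : C₂ ≌ C₃` an additive equivalence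
(intended `- ⊗ L^{∓1}`), so that `Ψ := D(F) ⋙ D(Φe)` is full and faithful and
`θ x = Ψ x ≫ (Ψ.commShiftIso 2)_{E₀}` is a bijection on `Hom_{D(X₀)}(E₀, E₀⟦2⟧)` (dimension `18` for the
two-term `E₀`); (b) Buchweitz–Flenner algebra data with the LEIBNIZ RULE `a′ = θ_R a + c`, the COMMUTATION and the
trace compatibilities, realising the (abstract) components `σ_q`, `σ′_q` and tied to `θ` by
`ι′(θ x) = θ_R(ι x)`; (c) injective diagonals `d_q` (intended `π^*` on `H^{q+2}(Ω^q)`). THEN: all `σ_q`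
jointly injective on `Hom(E₀, E₀⟦2⟧)` (FULL `σ_{E₀}` injective) ⟹ all `σ′_q` jointly injective on
`Hom(ΨE₀, (ΨE₀)⟦2⟧)` (FULL `σ_{E₀′}` injective). [cite: BuchweitzFlenner2003, Def. 4.1 and §5; Atiyah1957,
Prop. 10–12; GortzWedhorn2023, Prop. F.191; Lieblich2007, arXiv Lemma 2.1.1.12] -/
theorem jointlyInjective_univ_complex_of_exactAdjunction_equivalence_of_leibniz (θ : R →+* R') {a : R}
    {a' c : R'} (ha' : a' = θ a + c) (hc : Commute (θ a) c)
    (τ : ∀ q, R →+ W q) (τ' : ∀ q, R' →+ W' q) (d : ∀ q, W q →+ W' q)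
    (hd : ∀ (q : ℕ) (y : R), τ' q (θ y) = d q (τ q y))
    (μ : ∀ q j, W' j →+ W' q)
    (hμ : ∀ (q j : ℕ) (y : R'), j ≤ q → τ' q (y * c ^ (q - j)) = μ q j (τ' j y))
    (ι : (DerivedCategory.Q.obj E₀ ⟶ (DerivedCategory.Q.obj E₀)⟦(2 : ℤ)⟧) →+ R)
    (ι' : (((F.mapDerivedCategory ⋙ Φe.functor.mapDerivedCategory).obj (DerivedCategory.Q.obj E₀) ⟶
      ((F.mapDerivedCategory ⋙ Φe.functor.mapDerivedCategory).obj (DerivedCategory.Q.obj E₀))⟦(2 : ℤ)⟧)) →+ R')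
    (hθ₀ : ∀ x : DerivedCategory.Q.obj E₀ ⟶ (DerivedCategory.Q.obj E₀)⟦(2 : ℤ)⟧,
      ι' ((F.mapDerivedCategory ⋙ Φe.functor.mapDerivedCategory).map x ≫
        (((F.mapDerivedCategory ⋙ Φe.functor.mapDerivedCategory).commShiftIso (2 : ℤ)).app _).hom) =
        θ (ι x))
    (hσ : ∀ (q : ℕ) (x : DerivedCategory.Q.obj E₀ ⟶ (DerivedCategory.Q.obj E₀)⟦(2 : ℤ)⟧),
      σ q x = τ q (ι x * a ^ q))
    (hσ' : ∀ (q : ℕ) (x' : (F.mapDerivedCategory ⋙ Φe.functor.mapDerivedCategory).obj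
        (DerivedCategory.Q.obj E₀) ⟶
      ((F.mapDerivedCategory ⋙ Φe.functor.mapDerivedCategory).obj (DerivedCategory.Q.obj E₀))⟦(2 : ℤ)⟧),
      σ' q x' = τ' q (ι' x' * a' ^ q))
    (hdI : ∀ q, Function.Injective (d q))
    (h : ∀ x : DerivedCategory.Q.obj E₀ ⟶ (DerivedCategory.Q.obj E₀)⟦(2 : ℤ)⟧, (∀ q, σ q x = 0) → x = 0)
    (x' : (F.mapDerivedCategory ⋙ Φe.functor.mapDerivedCategory).obj (DerivedCategory.Q.obj E₀) ⟶
      ((F.mapDerivedCategory ⋙ Φe.functor.mapDerivedCategory).obj (DerivedCategory.Q.obj E₀))⟦(2 : ℤ)⟧)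
    (hx' : ∀ q, σ' q x' = 0) : x' = 0 := by
  let Ψ := F.mapDerivedCategory ⋙ Φe.functor.mapDerivedCategory
  let θ₀ : (DerivedCategory.Q.obj E₀ ⟶ (DerivedCategory.Q.obj E₀)⟦(2 : ℤ)⟧) →+
      (Ψ.obj (DerivedCategory.Q.obj E₀) ⟶ (Ψ.obj (DerivedCategory.Q.obj E₀))⟦(2 : ℤ)⟧) :=
    AddMonoidHom.mk' (fun x => Ψ.map x ≫ ((Ψ.commShiftIso (2 : ℤ)).app _).hom) fun x y => by
      change Ψ.map (x + y) ≫ _ = Ψ.map x ≫ _ + Ψ.map y ≫ _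
      rw [Ψ.map_add]
      exact Preadditive.add_comp _ _ _ _ _ _
  exact jointlyInjective_univ_complex_of_exactAdjunction_equivalence adj Φe E₀ d
    (fun q j => (μ q j).comp ((d j).comp (DistribSMul.toAddMonoidHom _ (q.choose j)))) hdI
    (fun q x => sigma_leibniz_triangular (σ := σ) (σ' := σ') θ ha' hc τ τ' d hd μ hμ ι ι' θ₀ hθ₀ hσ hσ' q x)
    h x' hx'

end Complex

end Summit.Ventures.HSemireg
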